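import Literature.NumberTheory.LFunctions.KloostermanWeilReduction
import Literature.NumberTheory.LFunctions.KloostermanPrimePowerTools
import HarnessLib

/-!
# Route `PrimeLevelFamEdge`, crux K_A `MomentsBeyondDiagonal` (stmt-Parity-20007), line «petersson_layers» v4:
# the Petersson layers as BILINEAR Kloosterman forms — the product identity `S(a, b; c) = S(1, ab; c) = S(a', b'; c)`

Every layer `K_r` of the line's split (deck 21a `layer`, Petersson modulus `c = q·r`) is a finite sum of Kloosterman sums
`S(m₁n₁/d₁², m₂n₂/d₂²; qr)` coming from the AFE in `(n₁, n₂)`, the mollifier in `(m₁, m₂)` and Hecke's divisor sum over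
`dᵢ ∣ (mᵢ, nᵢ)`; writing `mᵢ = dᵢ mᵢ'`, `nᵢ = dᵢ nᵢ'` the two Kloosterman arguments are `a = m₁'n₁'`, `b = m₂'n₂'`.  Any
treatment of the layers BEYOND termwise Weil — the print band `(ρ_P, ρ_W]` of `stub_farP` (Pascadi, GAFA 2026 = arXiv:2511.08445,
Thm 7.1: a bound for `Σ_{(m,n,c)=1} α_m β_n S(am, n; c)`), the generic band, the core — needs the layer rewritten as a bilinear
form `Σ_{u,v} α_u β_v S(u, v; qr)` in variables of the prover's choosing, e.g. the BALANCED regrouping `u = m₁'m₂' ≤ q̂^{2Δ'}`,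
`v = n₁'n₂' ≲ q̂²` (in the unbalanced AFE boxes `n₁ ~ q̂², n₂ ~ 1` the grouping `(a, b)` itself is too lopsided for Thm 7.1 to
reach the cut `ρ_P`; see this hand's census on the crux item).  The regrouping rests on ONE algebraic fact, proved here for the
tree's `Literature.NumberTheory.LFunctions.kloostermanSum` (all moduli `c ≥ 1`, no primality):

* §1 `kloostermanSum_twist`: `S(a, b; c) = S(at, b t̄; c)` for a unit `t`; hence `kloostermanSum_mul_mul_swap_of_isUnit`:
  `S(xy, zw; c) = S(xz, yw; c)` as soon as `y` and `z` are units (no hypothesis on `x, w`).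
* §2 `kloostermanSum_natCast_eq_one_mul_of_coprime`: for natural `a, b` with `((a, b), c) = 1` (NOT: `a` or `b` a unit),
  `S(a, b; c) = S(1, ab; c)` — by twisted multiplicativity (the tree's `kloostermanSum_mul_of_coprime`) and induction over the
  coprime factorisation of `c`; at a prime power one of `a, b` is a unit.  Corollaries `kloostermanSum_natCast_eq_of_mul_eq`
  (`ab = a'b'`, both triples coprime ⇒ `S(a,b;c) = S(a',b';c)`) and `kloostermanSum_mul_mul_swap_of_coprime`
  (`S(m₁n₁, m₂n₂; c) = S(m₁m₂, n₁n₂; c)`), the form consumed by the regrouping; `(m, n, c) = 1` is exactly the summation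
  condition printed in Pascadi's Theorem 7.1.

Proof only (def-free helper toward `stub_farP` / `stub_band`); no layer is bounded here; K_A NOT proved; nothing about
Landau–Siegel zeros.
-/

noncomputable section

open Finset
open Literature.NumberTheory.LFunctions

namespace Summit.Parity.GeneralizedHardyLittlewood.Theorems.MomentsBeyondDiagonal.Layers

/-! ## §1. Twisting by a unit -/

/-- **Twist by a unit**: `S(a, b; c) = S(a t, b t⁻¹; c)` for `t ∈ (ℤ/cℤ)ˣ` (substitute `x ↦ t x` in
`Σ_x e((a x + b x̄)/c)`). [folklore] -/
theorem kloostermanSum_twist {c : ℕ} [NeZero c] (a b : ZMod c) (t : (ZMod c)ˣ) :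
    kloostermanSum c a b = kloostermanSum c (a * (t : ZMod c)) (b * ((t⁻¹ : (ZMod c)ˣ) : ZMod c)) := by
  rw [kloostermanSum_eq_sum_units, kloostermanSum_eq_sum_units]
  refine Fintype.sum_equiv (Equiv.mulLeft t⁻¹) _ _ fun u ↦ ?_
  simp only [Equiv.coe_mulLeft, mul_inv_rev, inv_inv, Units.val_mul]
  have h : ((t⁻¹ : (ZMod c)ˣ) : ZMod c) * (t : ZMod c) = 1 := Units.inv_mul t
  congr 2
  · linear_combination (-(a * (u : ZMod c))) * h
  · linear_combination (-(b * ((u⁻¹ : (ZMod c)ˣ) : ZMod c))) * h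

/-- **Swapping the inner factors across the two arguments**: if `y` and `z` are units of `ℤ/cℤ` then
`S(x y, z w; c) = S(x z, y w; c)` (twist by `t = z ȳ`). No hypothesis on `x`, `w`. [folklore] -/
theorem kloostermanSum_mul_mul_swap_of_isUnit {c : ℕ} [NeZero c] (x w : ZMod c) {y z : ZMod c}
    (hy : IsUnit y) (hz : IsUnit z) :
    kloostermanSum c (x * y) (z * w) = kloostermanSum c (x * z) (y * w) := by
  obtain ⟨uy, rfl⟩ := hy
  obtain ⟨uz, rfl⟩ := hz
  rw [kloostermanSum_twist (x * (uy : ZMod c)) ((uz : ZMod c) * w) (uy⁻¹ * uz)]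
  congr 1
  · rw [Units.val_mul]
    linear_combination (x * (uz : ZMod c)) * Units.mul_inv uy
  · rw [mul_inv_rev, inv_inv, Units.val_mul]
    linear_combination ((uy : ZMod c) * w) * Units.mul_inv uz

/-! ## §2. `S(a, b; c) = S(1, ab; c)` under `((a, b), c) = 1` -/

/-- At a prime power `p^n`, `((a, b), p^n) = 1` forces `p ∤ a` or `p ∤ b`. [folklore] -/
theorem not_dvd_or_not_dvd_of_coprime_prime_pow {p n a b : ℕ} (hp : p.Prime) (hn : 0 < n)
    (h : (Nat.gcd a b).Coprime (p ^ n)) : ¬ p ∣ a ∨ ¬ p ∣ b := by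
  by_cases ha : p ∣ a
  swap
  · exact Or.inl ha
  refine Or.inr fun hb ↦ ?_
  have h1 : p ∣ Nat.gcd a b := Nat.dvd_gcd ha hb
  have h2 : p ∣ p ^ n := dvd_pow_self p hn.ne'
  have h3 : p ∣ Nat.gcd (Nat.gcd a b) (p ^ n) := Nat.dvd_gcd h1 h2
  rw [h] at h3
  exact hp.one_lt.ne' (Nat.dvd_one.mp h3)

/-- A natural number prime to `p` is a unit modulo `p^n`. [folklore] -/
theorem isUnit_natCast_prime_pow_of_not_dvd {p n a : ℕ} (hp : p.Prime) (ha : ¬ p ∣ a) :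
    IsUnit ((a : ℕ) : ZMod (p ^ n)) := by
  rw [ZMod.isUnit_iff_coprime]
  exact ((Nat.Prime.coprime_iff_not_dvd hp).mpr ha).symm.pow_right n

/-- **`S(a, b; c) = S(1, ab; c)` whenever `((a, b), c) = 1`** — for every modulus `c ≥ 1` and natural `a, b`.
(For `(a, c) = 1` this is the substitution `x ↦ ā x`; in general neither `a` nor `b` need be a unit — e.g.
`S(2, 3; 6) = S(1, 0; 6) = 1` — and the identity is assembled prime power by prime power through twisted
multiplicativity, Iwaniec–Kowalski (1.59).) [folklore] -/
theorem kloostermanSum_natCast_eq_one_mul_of_coprime :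
    ∀ (c : ℕ) [NeZero c] (a b : ℕ), (Nat.gcd a b).Coprime c →
      kloostermanSum c (a : ZMod c) (b : ZMod c) = kloostermanSum c 1 ((a : ZMod c) * (b : ZMod c)) := by
  intro c
  induction c using Nat.recOnPosPrimePosCoprime with
  | zero => intro h; exact (NeZero.ne 0 rfl).elim
  | one =>
    intro _ a b _
    congr 1 <;> exact Subsingleton.elim _ _
  | prime_pow p n hp hn =>
    intro _ a b h
    rcases not_dvd_or_not_dvd_of_coprime_prime_pow hp hn h with ha | hb
    · exact kloostermanSum_eq_one_mul (isUnit_natCast_prime_pow_of_not_dvd hp ha) _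
    · rw [kloostermanSum_comm, kloostermanSum_eq_one_mul (isUnit_natCast_prime_pow_of_not_dvd hp hb), mul_comm]
  | coprime c₁ c₂ hc₁ hc₂ hcop ih₁ ih₂ =>
    intro _ a b h
    haveI : NeZero c₁ := ⟨by omega⟩
    haveI : NeZero c₂ := ⟨by omega⟩
    -- the CRT units `e₂ = c̄₂ (mod c₁)`, `e₁ = c̄₁ (mod c₂)` and natural representatives
    have hu₂ : IsUnit ((c₂ : ZMod c₁)⁻¹) :=
      IsUnit.of_mul_eq_one _ (ZMod.inv_mul_of_unit _ ((ZMod.isUnit_iff_coprime c₂ c₁).mpr hcop.symm))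
    have hu₁ : IsUnit ((c₁ : ZMod c₂)⁻¹) :=
      IsUnit.of_mul_eq_one _ (ZMod.inv_mul_of_unit _ ((ZMod.isUnit_iff_coprime c₁ c₂).mpr hcop))
    set E₂ : ℕ := ((c₂ : ZMod c₁)⁻¹).val with hE₂
    set E₁ : ℕ := ((c₁ : ZMod c₂)⁻¹).val with hE₁
    have hE₂c : ((E₂ : ℕ) : ZMod c₁) = (c₂ : ZMod c₁)⁻¹ := ZMod.natCast_zmod_val _
    have hE₁c : ((E₁ : ℕ) : ZMod c₂) = (c₁ : ZMod c₂)⁻¹ := ZMod.natCast_zmod_val _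
    have hE₂cop : E₂.Coprime c₁ := (ZMod.isUnit_iff_coprime E₂ c₁).mp (hE₂c ▸ hu₂)
    have hE₁cop : E₁.Coprime c₂ := (ZMod.isUnit_iff_coprime E₁ c₂).mp (hE₁c ▸ hu₁)
    have hab₁ : (Nat.gcd a b).Coprime c₁ := Nat.Coprime.coprime_dvd_right (dvd_mul_right c₁ c₂) h
    have hab₂ : (Nat.gcd a b).Coprime c₂ := Nat.Coprime.coprime_dvd_right (dvd_mul_left c₂ c₁) h
    have h₁ : (Nat.gcd (E₂ * a) (E₂ * b)).Coprime c₁ := by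
      rw [Nat.gcd_mul_left]
      exact Nat.Coprime.mul_left hE₂cop hab₁
    have h₂ : (Nat.gcd (E₁ * a) (E₁ * b)).Coprime c₂ := by
      rw [Nat.gcd_mul_left]
      exact Nat.Coprime.mul_left hE₁cop hab₂
    have i₁ := ih₁ (E₂ * a) (E₂ * b) h₁
    have i₂ := ih₂ (E₁ * a) (E₁ * b) h₂
    push_cast at i₁ i₂
    rw [hE₂c] at i₁
    rw [hE₁c] at i₂
    rw [kloostermanSum_mul_of_coprime hcop, kloostermanSum_mul_of_coprime hcop 1]
    simp only [map_natCast, map_mul, map_one, mul_one]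
    rw [i₁, i₂, kloostermanSum_eq_one_mul hu₂, kloostermanSum_eq_one_mul hu₁]
    congr 2 <;> ring

/-- **Only the product and the coprimality class matter**: if `a b = a' b'` and both `((a,b), c) = 1`,
`((a',b'), c) = 1`, then `S(a, b; c) = S(a', b'; c)`. [folklore] -/
theorem kloostermanSum_natCast_eq_of_mul_eq {c : ℕ} [NeZero c] {a b a' b' : ℕ} (h : a * b = a' * b')
    (hab : (Nat.gcd a b).Coprime c) (hab' : (Nat.gcd a' b').Coprime c) :
    kloostermanSum c (a : ZMod c) (b : ZMod c) = kloostermanSum c (a' : ZMod c) (b' : ZMod c) := by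
  rw [kloostermanSum_natCast_eq_one_mul_of_coprime c a b hab, kloostermanSum_natCast_eq_one_mul_of_coprime c a' b' hab']
  congr 1
  exact_mod_cast congrArg (fun k : ℕ ↦ (k : ZMod c)) h

/-- **The regrouping identity for the Petersson layers**: for natural `m₁, n₁, m₂, n₂` with
`((m₁n₁, m₂n₂), c) = 1` and `((m₁m₂, n₁n₂), c) = 1`,
`S(m₁ n₁, m₂ n₂; c) = S(m₁ m₂, n₁ n₂; c)` — the Kloosterman sum of a Hecke-split layer term depends on
`(m₁', n₁', m₂', n₂')` only through the mollifier product `u = m₁'m₂'` and the AFE product `v = n₁'n₂'`. [folklore] -/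
theorem kloostermanSum_mul_mul_swap_of_coprime {c : ℕ} [NeZero c] (m₁ n₁ m₂ n₂ : ℕ)
    (h₁ : (Nat.gcd (m₁ * n₁) (m₂ * n₂)).Coprime c) (h₂ : (Nat.gcd (m₁ * m₂) (n₁ * n₂)).Coprime c) :
    kloostermanSum c ((m₁ * n₁ : ℕ) : ZMod c) ((m₂ * n₂ : ℕ) : ZMod c) =
      kloostermanSum c ((m₁ * m₂ : ℕ) : ZMod c) ((n₁ * n₂ : ℕ) : ZMod c) :=
  kloostermanSum_natCast_eq_of_mul_eq (by ring) h₁ h₂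

/-- A convenient sufficient condition for BOTH coprimality hypotheses of `kloostermanSum_mul_mul_swap_of_coprime`:
`(m₁ m₂ n₁ n₂, c) = 1` (the generic term of a layer when `c = q r` and `r` is prime to the four variables). [folklore] -/
theorem coprime_gcd_of_coprime_prod {c m₁ n₁ m₂ n₂ : ℕ} (h : (m₁ * m₂ * n₁ * n₂).Coprime c) :
    (Nat.gcd (m₁ * n₁) (m₂ * n₂)).Coprime c ∧ (Nat.gcd (m₁ * m₂) (n₁ * n₂)).Coprime c := by
  constructor
  · exact Nat.Coprime.coprime_dvd_left
      ((Nat.gcd_dvd_left _ _).trans ⟨m₂ * n₂, by ring⟩) h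
  · exact Nat.Coprime.coprime_dvd_left
      ((Nat.gcd_dvd_left _ _).trans ⟨n₁ * n₂, by ring⟩) h

/-- With the four variables prime to `c`, the swap holds (generic layer term). [folklore] -/
theorem kloostermanSum_mul_mul_swap_of_coprime_prod {c : ℕ} [NeZero c] {m₁ n₁ m₂ n₂ : ℕ}
    (h : (m₁ * m₂ * n₁ * n₂).Coprime c) :
    kloostermanSum c ((m₁ * n₁ : ℕ) : ZMod c) ((m₂ * n₂ : ℕ) : ZMod c) =
      kloostermanSum c ((m₁ * m₂ : ℕ) : ZMod c) ((n₁ * n₂ : ℕ) : ZMod c) :=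
  kloostermanSum_mul_mul_swap_of_coprime m₁ n₁ m₂ n₂ (coprime_gcd_of_coprime_prod h).1
    (coprime_gcd_of_coprime_prod h).2

end Summit.Parity.GeneralizedHardyLittlewood.Theorems.MomentsBeyondDiagonal.Layers

end
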